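import Mathlib
import Summits.Ventures.PercRepro.TriangleCapStarFamilyOffDeg
import Summits.Ventures.PercRepro.TriangleCapDeficiency
import Summits.Ventures.PercRepro.TriangleCapLayers

/-!
# PercRepro — THE STAR FAMILY WITNESS: A GRAPH OF THE BAND WHOSE ONLY DEFICITS ARE THE CENTRE AND THE SHORT ROW
(p3, gen 56; part 318)

The graph `HSF` of part 317 on `ℓ + 1 + (s − t)` vertices, `t = Rc + a (D − 1) + Q D + a`, is a graph of the band
(triangle-free, `s` edges, `w` of degree `s − t`, every off-degree `≤ D`, a non-neighbour of off-degree exactly `D`)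
with `a` inside edges and the deficiency `Σ_{v ≠ w} c(v) (D − c(v)) = (Rc + a)(D − Rc − a) + (D − short) short`
(the centre and the short row are the only vertices with `0 < c < D`), so by the deficiency identity of part 282
its band value is `2 j + 2 t (D − 1) = t (t − 1) + 2 a + (Rc + a)(D − Rc − a) + (D − short) short`
(`starFamilyWitness`).  Parts 319–320 pick the parameters attaining the residue minimum of part 312.
Axioms: standard.
-/

namespace PercRepro

namespace TriangleCap

namespace C047

open Finset

/-- Every off-degree of the star family is at most `D`. -/
theorem offSF_le (ℓ D a Rc short E Q v : ℕ) (ha : 1 ≤ a) (hRc : 1 ≤ Rc) (haR : a + Rc ≤ D)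
    (hshort : short + 1 ≤ D) : offSF ℓ D a Rc short E Q v ≤ D := by
  unfold offSF kSF
  split_ifs <;> omega

/-- The special `1` has off-degree `D`. -/
theorem offSF_one (ℓ D a Rc short E Q : ℕ) (ha : 1 ≤ a) : offSF ℓ D a Rc short E Q 1 = D := by
  unfold offSF
  rw [if_neg (show ¬ (1 = 0) by omega), if_pos ha]

/-- The centre has off-degree `Rc + a`. -/
theorem offSF_centre (ℓ D a Rc short E Q : ℕ) (ha : 1 ≤ a) : offSF ℓ D a Rc short E Q (a + Q + 1) = Rc + a := by
  unfold offSF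
  rw [if_neg (show ¬ (a + Q + 1 = 0) by omega), if_neg (show ¬ (a + Q + 1 ≤ a) by omega),
    if_neg (show ¬ (a + Q + 1 ≤ a + Q) by omega), if_pos rfl]

/-- The first centre row has off-degree `D − short`. -/
theorem offSF_first_row (ℓ D a Rc short E Q : ℕ) (hRc : 1 ≤ Rc) (hshort : short + 1 ≤ D) (hℓ : a + Q + 1 ≤ ℓ) :
    offSF ℓ D a Rc short E Q (ℓ + 1) = D - short := by
  unfold offSF
  rw [if_neg (show ¬ (ℓ + 1 = 0) by omega), if_neg (show ¬ (ℓ + 1 ≤ a) by omega),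
    if_neg (show ¬ (ℓ + 1 ≤ a + Q) by omega), if_neg (show ¬ (ℓ + 1 = a + Q + 1) by omega),
    if_neg (show ¬ (ℓ + 1 ≤ ℓ) by omega), if_pos (show ℓ + 1 < ℓ + 1 + Rc by omega), Nat.sub_self]
  unfold kSF
  rw [if_pos rfl]
  omega

/-- Every vertex other than `0`, the centre and the first centre row has off-degree `0` or `D`. -/
theorem offSF_zero_or (ℓ D a Rc short E Q v : ℕ) (ha : 1 ≤ a) (hRc : 1 ≤ Rc) (haR : a + Rc ≤ D)
    (hshort : short + 1 ≤ D) (hvc : v ≠ a + Q + 1) (hv1 : v ≠ ℓ + 1) :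
    offSF ℓ D a Rc short E Q v = 0 ∨ offSF ℓ D a Rc short E Q v = D := by
  unfold offSF kSF
  split_ifs <;> omega

/-- **THE DEFICIENCY OF THE STAR FAMILY:** `Σ_{v ≠ w} c(v) (D − c(v)) = (Rc + a)(D − Rc − a) + (D − short) short`. -/
theorem sum_deficiency_HSF (s ℓ t D a Rc short E Q : ℕ) (ha : 1 ≤ a) (hRc : 1 ≤ Rc) (haR : a + Rc ≤ D)
    (hshort : short + 1 ≤ D) (hQ : 1 ≤ Q) (hQ1 : D ≤ Q + 1) (hQE : 1 ≤ E → D ≤ Q)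
    (hinc : Rc * (D - 1) + (D - 1) * (D - a) + E * D = Q * D + short) (hℓ : a + Q + 1 ≤ ℓ)
    (hN : Rc + (D - 1) + E ≤ s - t) :
    ∑ v ∈ univ.erase (fin' (nSF s ℓ t) (nSF_pos s ℓ t) 0),
      offDeg (HSF s ℓ t D a Rc short E Q) (fin' (nSF s ℓ t) (nSF_pos s ℓ t) 0) v *
        (D - offDeg (HSF s ℓ t D a Rc short E Q) (fin' (nSF s ℓ t) (nSF_pos s ℓ t) 0) v) =
      (Rc + a) * (D - (Rc + a)) + (D - short) * short := by
  have hC : a + Q + 1 < nSF s ℓ t := by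
    unfold nSF
    omega
  have h1 : ℓ + 1 < nSF s ℓ t := by
    unfold nSF
    omega
  have hne : fin' (nSF s ℓ t) (nSF_pos s ℓ t) (a + Q + 1) ≠ fin' (nSF s ℓ t) (nSF_pos s ℓ t) (ℓ + 1) :=
    fin'_ne' _ _ _ _ hC h1 (by omega)
  have h₀ : ∀ v ∈ univ.erase (fin' (nSF s ℓ t) (nSF_pos s ℓ t) 0),
      v ≠ fin' (nSF s ℓ t) (nSF_pos s ℓ t) (a + Q + 1) ∧ v ≠ fin' (nSF s ℓ t) (nSF_pos s ℓ t) (ℓ + 1) →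
      offDeg (HSF s ℓ t D a Rc short E Q) (fin' (nSF s ℓ t) (nSF_pos s ℓ t) 0) v *
        (D - offDeg (HSF s ℓ t D a Rc short E Q) (fin' (nSF s ℓ t) (nSF_pos s ℓ t) 0) v) = 0 := by
    intro v hv hvne
    rw [mem_erase] at hv
    have hvv : v = fin' (nSF s ℓ t) (nSF_pos s ℓ t) v.val := Fin.ext (by rw [fin'_val _ _ _ v.isLt])
    have hvc : v.val ≠ a + Q + 1 := by
      intro h
      apply hvne.1
      rw [hvv, h]
    have hv1 : v.val ≠ ℓ + 1 := by
      intro h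
      apply hvne.2
      rw [hvv, h]
    rw [hvv, offDeg_HSF s ℓ t D a Rc short E Q ha hRc hshort hQ hQ1 hQE hinc hℓ hN v.val v.isLt]
    rcases offSF_zero_or ℓ D a Rc short E Q v.val ha hRc haR hshort hvc hv1 with h | h
    · rw [h, zero_mul]
    · rw [h, Nat.sub_self, mul_zero]
  rw [sum_eq_add _ _ hne h₀ (fun h => absurd (mem_erase.mpr ⟨fin'_ne' _ _ _ _ hC (nSF_pos s ℓ t) (by omega),
      mem_univ _⟩) h)
    (fun h => absurd (mem_erase.mpr ⟨fin'_ne' _ _ _ _ h1 (nSF_pos s ℓ t) (by omega), mem_univ _⟩) h),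
    offDeg_HSF s ℓ t D a Rc short E Q ha hRc hshort hQ hQ1 hQE hinc hℓ hN (a + Q + 1) hC,
    offDeg_HSF s ℓ t D a Rc short E Q ha hRc hshort hQ hQ1 hQE hinc hℓ hN (ℓ + 1) h1,
    offSF_centre ℓ D a Rc short E Q ha, offSF_first_row ℓ D a Rc short E Q hRc hshort hℓ]
  have e : D - (D - short) = short := by omega
  rw [e]

/-- **THE ATTACHMENT OF THE STAR FAMILY:** every cross pair ends at a leaf, the inside edges at none:
`attach = Rc + a (D − 1) + Q D`. -/
theorem attach_HSF (s ℓ t D a Rc short E Q : ℕ) (ht : t = Rc + a * (D - 1) + Q * D + a) (ha : 1 ≤ a)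
    (hRc : 1 ≤ Rc) (hshort : short + 1 ≤ D) (hQ : 1 ≤ Q) (hQ1 : D ≤ Q + 1) (hQE : 1 ≤ E → D ≤ Q)
    (hinc : Rc * (D - 1) + (D - 1) * (D - a) + E * D = Q * D + short) (hℓ : a + Q + 1 ≤ ℓ)
    (hN : Rc + (D - 1) + E ≤ s - t) (hs : 2 * t ≤ s) :
    attach (HSF s ℓ t D a Rc short E Q) (fin' (nSF s ℓ t) (nSF_pos s ℓ t) 0) = Rc + a * (D - 1) + Q * D := by
  have hg := goodEnds_SF (nSF s ℓ t) ℓ D a Rc short E Q ha hRc hshort hQ hQ1 hQE hinc hℓ (by unfold nSF; omega)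
  have hatt := attach_genWitness (nSF s ℓ t) (ℓ + 1) (s - a) (Rc + a * (D - 1) + Q * D) (nSF_pos s ℓ t)
    (lfSF D a Rc Q) (rfSF ℓ D a Rc short E) hg (by omega) (by unfold nSF; omega)
  have hall : ((range (Rc + a * (D - 1) + Q * D)).filter
      (fun i => rfSF ℓ D a Rc short E i < ℓ + 1 + (s - a - (Rc + a * (D - 1) + Q * D)))).card =
      Rc + a * (D - 1) + Q * D := by
    rw [filter_true_of_mem (fun i hi => by
      have := rfSF_bounds ℓ D a Rc short E Q i ha hRc hshort hinc (mem_range.mp hi)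
      omega), card_range]
  have hsame : attach (HSF s ℓ t D a Rc short E Q) (fin' (nSF s ℓ t) (nSF_pos s ℓ t) 0) =
      attach (H0SF s ℓ t D a Rc short E Q) (fin' (nSF s ℓ t) (nSF_pos s ℓ t) 0) := by
    unfold attach
    apply sum_congr
    · apply filter_congr
      intro v _
      exact addEdges_adj_of_notMem _ _ _ (SSF_zero s ℓ t a Q hℓ) v
    intro v hv
    rw [mem_filter] at hv
    rw [offDeg_addEdges _ _ (SSF_nondiag s ℓ t a Q hℓ) (SSF_new s ℓ t D a Rc short E Q hℓ) _
      (SSF_zero s ℓ t a Q hℓ) v]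
    have hv' : ℓ + 1 ≤ v.val := by
      by_contra hcon
      rw [not_le] at hcon
      exact not_adj_H0SF_left s ℓ t D a Rc short E Q _ v (by rw [fin'_val _ _ 0 (nSF_pos s ℓ t)]; omega) hcon
        hv.2
    have hzero : ((SSF s ℓ t a Q).filter (fun e => v ∈ e)).card = 0 := by
      rw [card_eq_zero, filter_eq_empty_iff]
      intro e he hve
      have := SSF_ends s ℓ t a Q hℓ e he v hve
      omega
    rw [hzero, add_zero]
  rw [hsame, hatt, hall]

/-- **THE STAR FAMILY WITNESS:** for `1 ≤ a`, `1 ≤ Rc`, `a + Rc ≤ D`, `short < D`, `D − 1 ≤ Q` (and `D ≤ Q` when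
there are extra rows), the incidence identity `Rc (D − 1) + (D − 1)(D − a) + E D = Q D + short`,
`a + Q + 1 ≤ ℓ` non-neighbours and `2 t ≤ s` with `t = Rc + a (D − 1) + Q D + a`: a triangle-free graph on
`ℓ + 1 + (s − t)` vertices with `s` edges, a vertex `w` of degree `s − t`, every off-degree `≤ D`, a non-neighbour
of off-degree exactly `D`, and the band value `2 j + 2 t (D − 1) = t (t − 1) + 2 a + (Rc + a)(D − Rc − a) + (D − short) short`. -/
theorem starFamilyWitness (s ℓ t D a Rc short E Q : ℕ) (ht : t = Rc + a * (D - 1) + Q * D + a) (ha : 1 ≤ a)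
    (hRc : 1 ≤ Rc) (haR : a + Rc ≤ D) (hshort : short + 1 ≤ D) (hQ : 1 ≤ Q) (hQ1 : D ≤ Q + 1)
    (hQE : 1 ≤ E → D ≤ Q) (hinc : Rc * (D - 1) + (D - 1) * (D - a) + E * D = Q * D + short)
    (hℓ : a + Q + 1 ≤ ℓ) (hs : 2 * t ≤ s) :
    ∃ (H : SimpleGraph (Fin (ℓ + 1 + (s - t)))) (_ : DecidableRel H.Adj), H.CliqueFree 3 ∧
      H.edgeFinset.card = s ∧ ∃ w, deg H w + t = s ∧ (∀ v, offDeg H w v ≤ D) ∧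
        (∃ x, ¬ H.Adj w x ∧ offDeg H w x = D) ∧
        ∃ j, ∑ v, deg H v * deg H v + 2 * (t * (s - t - 1)) + 2 * j = s * (s + 1) ∧
          2 * j + 2 * (t * (D - 1)) =
            t * (t - 1) + 2 * a + ((Rc + a) * (D - (Rc + a)) + (D - short) * short) := by
  -- the rows fit among the leaves: `E ≤ Q` by the incidence identity, so `Rc + (D − 1) + E ≤ t ≤ s − t`
  have hEQ : E ≤ Q := by
    have h1 : E * D < (Q + 1) * D := by
      rw [Nat.succ_mul]
      omega
    have := Nat.lt_of_mul_lt_mul_right h1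
    omega
  have hN : Rc + (D - 1) + E ≤ s - t := by
    have h1 : D - 1 ≤ a * (D - 1) := Nat.le_mul_of_pos_left (D - 1) ha
    have h2 : Q ≤ Q * D := Nat.le_mul_of_pos_right Q (by omega)
    omega
  have hD0 : 0 < D := by omega
  have hfree := cliqueFree_HSF s ℓ t D a Rc short E Q ha hRc hshort hQ hQ1 hQE hinc hℓ hN
  have hcard := card_edges_HSF s ℓ t D a Rc short E Q ht ha hRc hshort hQ hQ1 hQE hinc hℓ hN hs
  have hdeg := deg_HSF_zero s ℓ t D a Rc short E Q ht ha hRc hshort hQ hQ1 hQE hinc hℓ hN hs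
  have hDle : ∀ v, offDeg (HSF s ℓ t D a Rc short E Q) (fin' (nSF s ℓ t) (nSF_pos s ℓ t) 0) v ≤ D := by
    intro v
    have hvv : v = fin' (nSF s ℓ t) (nSF_pos s ℓ t) v.val := Fin.ext (by rw [fin'_val _ _ _ v.isLt])
    rw [hvv, offDeg_HSF s ℓ t D a Rc short E Q ha hRc hshort hQ hQ1 hQE hinc hℓ hN v.val v.isLt]
    exact offSF_le ℓ D a Rc short E Q v.val ha hRc haR hshort
  have ht1 : 1 ≤ t := by omega
  have hw1 : 1 ≤ deg (HSF s ℓ t D a Rc short E Q) (fin' (nSF s ℓ t) (nSF_pos s ℓ t) 0) := by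
    rw [hdeg]
    omega
  obtain ⟨j, -, hj⟩ := sum_deg_sq_layer (HSF s ℓ t D a Rc short E Q) hfree (fin' (nSF s ℓ t) (nSF_pos s ℓ t) 0) hw1
  have hoff : (offEdges (HSF s ℓ t D a Rc short E Q) (fin' (nSF s ℓ t) (nSF_pos s ℓ t) 0)).card = t := by
    have := card_offEdges_add_deg (HSF s ℓ t D a Rc short E Q) (fin' (nSF s ℓ t) (nSF_pos s ℓ t) 0)
    rw [hdeg, hcard] at this
    omega
  rw [hoff, hdeg, hcard] at hj
  refine ⟨HSF s ℓ t D a Rc short E Q, inferInstance, hfree, hcard, fin' (nSF s ℓ t) (nSF_pos s ℓ t) 0, ?_, hDle,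
    ?_, j, hj, ?_⟩
  · rw [hdeg]
    omega
  · refine ⟨fin' (nSF s ℓ t) (nSF_pos s ℓ t) 1, ?_, ?_⟩
    · rw [addEdges_adj_of_notMem _ _ _ (SSF_zero s ℓ t a Q hℓ)]
      exact not_adj_genWitness_one (nSF s ℓ t) (ℓ + 1) (s - a) (Rc + a * (D - 1) + Q * D) (nSF_pos s ℓ t)
        (lfSF D a Rc Q) (rfSF ℓ D a Rc short E) (by omega) (by unfold nSF; omega)
    · rw [offDeg_HSF s ℓ t D a Rc short E Q ha hRc hshort hQ hQ1 hQE hinc hℓ hN 1 (by unfold nSF; omega)]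
      exact offSF_one ℓ D a Rc short E Q ha
  · have hdef := deficiency_identity (HSF s ℓ t D a Rc short E Q) hfree s t j D hcard
      (fin' (nSF s ℓ t) (nSF_pos s ℓ t) 0) (by rw [hdeg]; omega) hw1 hj hDle
    have hins : (insideEdges (HSF s ℓ t D a Rc short E Q) (fin' (nSF s ℓ t) (nSF_pos s ℓ t) 0)).card = a := by
      have h1 := attach_add_card_inside (HSF s ℓ t D a Rc short E Q) hfree (fin' (nSF s ℓ t) (nSF_pos s ℓ t) 0)
      rw [attach_HSF s ℓ t D a Rc short E Q ht ha hRc hshort hQ hQ1 hQE hinc hℓ hN hs, hoff] at h1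
      omega
    rw [hdef, hins, sum_deficiency_HSF s ℓ t D a Rc short E Q ha hRc haR hshort hQ hQ1 hQE hinc hℓ hN]

end C047

end TriangleCap

end PercRepro
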